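import Literature.NumberTheory.EllipticCurves.ComplexMultiplicationBurungaleFlachFiniteProofs
import Literature.NumberTheory.EllipticCurves.ComplexMultiplicationCoatesWilesProofs
import Literature.NumberTheory.EllipticCurves.ComplexMultiplicationDeuringArtinProofs
import Literature.NumberTheory.EllipticCurves.ComplexMultiplicationLFunctionIsogenyProofs
import Literature.NumberTheory.EllipticCurves.ComplexMultiplicationTwistIsogenyProofs
import HarnessLib

/-!
# bsd.S28 (Burungale–Flach): the assembly from the current terminal leaves of the tree

Sixth proof file of `Literature.NumberTheory.EllipticCurves.ComplexMultiplication` for **bsd.S28**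
(`Literature.NumberTheory.EllipticCurves.bsdTriple_of_j_mem_maximalCMJInvariants_of_L_one_ne_zero`,
the full Birch–Swinnerton-Dyer statement for `E/ℚ` with CM by a maximal order and `L(E,1) ≠ 0`;
Burungale–Flach, Camb. J. Math. 12 (2024), Thm. 1.1 and Cor. 2). It adds no mathematics: it only
composes the reductions proved in the sibling files into **one theorem whose hypotheses are
exactly the named facts on which bsd.S28 currently rests** (its trust base), so that the state of
the decomposition can be read off a single statement and every remaining leaf registers as a
dependency of the target:

`bsdTriple_of_j_mem_maximalCMJInvariants_of_L_one_ne_zero_of_eleven_leaves` — bsd.S28 follows,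
sorry-free, from

1. `BurungaleFlach2024_main_cmField_pPart` — Burungale–Flach, Prop. 2.3 with Lemma 13 at `F = K`
   for every rational prime `p` (the two-variable main conjecture of Johnson-Leung–Kings, its
   descent Prop. 4.1 and Kato's explicit reciprocity law; for `𝔭 ∤ #𝓞_K^×` also Rubin 1991): the
   one leaf that is the paper's own contribution (`ComplexMultiplicationBurungaleFlachPrimaryProofs`);
2. `Rubin1987_sha_primary_finite` — Rubin, Invent. Math. 89 (1987), §10: `Ш(E_K/K)[p^∞]` finite
   (`ComplexMultiplicationShaRubinProofs`);
3. `CoatesWiles1977_L_one_div_period_mem_prime` — Coates–Wiles, Invent. Math. 39 (1977), §6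
   (Thm. 29, Cor. 32, Thm. 34, Lemma 35): the `𝔭`-divisibility of `Ω⁻¹ L(E/ℚ,1)` forced by a point
   of infinite order (`ComplexMultiplicationCoatesWiles`);
4. `singularModuli_classNumberOne_three` — the three singular moduli `j(𝓞_K)` for
   `d_K = -43, -67, -163` (Cox, table (12.20); the other six rows are theorems,
   `ComplexMultiplicationSingularModuliRows`);
5. `hasEntireLFunction_rat` — modularity: `L(E/ℚ,s)` is entire (Wiles, BCDT; `AnalyticRank`);
6. `LSeries_baseChange_quadratic` — Artin formalism `L(E_K/K,s) = L(E,s) L(E^{(d_K)},s)`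
   (Ireland–Rosen 20.5.4; `BSDQuadraticDescent`);
7. `bsdRHS_baseChange_quadratic` — Milne 1972, Thm. 1 (BSD quotient of a Weil restriction) in
   rank-zero shape (`BSDQuadraticDescent`);
8. `bsdRHS_eq_of_isIsogenous` — Cassels 1965 / Milne *ADT* I.7.3: the BSD quotient is an isogeny
   invariant (`BSDQuadraticDescent`);
9. `WeierstrassCurve.hasseWeilEulerFactor_geomPoints W ℓ` for all elliptic `W/ℚ` and primes `ℓ` —
   the local Euler factor of Mathlib's `L`-function is `det(1 - Frob_p T ∣ V_ℓ(E)^{I_p})`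
   (Serre–Tate 1968, Thm. 3; `HasseWeilAbelian`), whence Knapp 11.67
   (`ComplexMultiplicationLFunctionIsogenyProofs`);
10. `re_entireLFunction_one_nonneg` — `L(E,1) ≥ 0` (Guo 1996; Lapid–Rallis 2003, Thm. 1;
    `BSDQuadraticDescent`);
11. `isIsogenous_quadraticTwist_cmFieldDiscr_models` — the six `ℚ`-isogenies `E_D ∼ E_D^{(D)}`,
    `D ∈ {-7, -11, -19, -43, -67, -163}` (Milne 1972, Thm. 3; the cases `j = 0, 1728, 8000` are
    theorems, `ComplexMultiplicationTwistIsogenyProofs`);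

through the derived facts: the full table of singular moduli (4 ⇒ `singularModuli_classNumberOne`),
the CM period lattice `Λ_E = Ω 𝓞_K` (⇒ `exists_isCMPeriod_of_j_mem_maximalCMJInvariants`),
Coates–Wiles Thm. 1 and, with the Mordell–Weil theorem (proved in the tree), the finiteness of
`E(ℚ)` (3, 4 ⇒ `finite_point_of_j_mem_maximalCMJInvariants_of_L_one_ne_zero`), Knapp 11.67
(9 ⇒ `LFunction_eq_of_isIsogenous`), the CM twist isogeny for all nine `j`
(11 ⇒ `isIsogenous_quadraticTwist_cmFieldDiscr`), Deuring's `L(E_K/K,s) = L(E/ℚ,s)²`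
(6, 9, 11 ⇒ `Deuring_LFunction_baseChange_cmField`), the finiteness half of Theorem 1.1
(`BurungaleFlach2024_finite_primary_cmField_of_classical`), and the level-4/3/2/1 assemblies.
Of the eleven, 1 is the theory of the paper; 2, 3, 5–10 are classical printed theorems; 4 and 11
are finite computations (three `q`-expansion evaluations, six explicit cyclic isogenies of degrees
`7, 11, 19, 43, 67, 163`).

## References

* A. Burungale, M. Flach, *The conjecture of Birch and Swinnerton-Dyer for certain elliptic curves
  with complex multiplication*, Camb. J. Math. 12 (2024) (arXiv:2206.09874), Thm. 1.1, Cor. 1,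
  Cor. 2, Prop. 2.3, Prop. 4.1, Remark 10, Lemma 13. [BurungaleFlach2024]
* the sources of the eleven leaves, cited at their definitions.
-/

noncomputable section

open scoped Classical

namespace Literature.NumberTheory.EllipticCurves

open WeierstrassCurve

/-- **bsd.S28 from the eleven current leaves of its decomposition** (see the module docstring for
the list and the provenance of each): Burungale–Flach Prop. 2.3 with Lemma 13 at `F = K` (`hB`),
Rubin 1987 §10 (`hR`), Coates–Wiles 1977 §6 (`h1`), the three singular moduli `d_K = -43, -67,
-163` (`h3`), modularity (`hmod`), Artin formalism (`hBCL`), Milne 1972 Thm. 1 (`hBC`), Cassels'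
isogeny invariance (`hISO`), the Euler factors of the Tate module (`hHW`), `L(E,1) ≥ 0` (`hPOS`)
and the six CM twist isogenies (`hTW₆`); everything else — Mordell–Weil, six singular moduli,
three twist isogenies, the dual isogeny and `V_ℓ`-comparison behind Knapp 11.67, Deuring from
Artin formalism, class number one of the nine fields, global minimal models, the period
dictionary, the quadratic descent of finiteness, `Ш` and `E(K)` under changes of variables, and
the bookkeeping of Thm. 1.1 ⇒ Cor. 1 ⇒ Cor. 2 ⇒ bsd.S28 — being proved in the tree.
[cite: BurungaleFlach2024, Thm. 1.1, Cor. 1, Cor. 2 and proof of Thm. 1.1 (arXiv pp. 3–4, 22)] -/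
theorem bsdTriple_of_j_mem_maximalCMJInvariants_of_L_one_ne_zero_of_eleven_leaves
    (hB : BurungaleFlach2024_main_cmField_pPart) (hR : Rubin1987_sha_primary_finite)
    (h1 : CoatesWiles1977_L_one_div_period_mem_prime) (h3 : singularModuli_classNumberOne_three)
    (hmod : hasEntireLFunction_rat) (hBCL : LSeries_baseChange_quadratic)
    (hBC : bsdRHS_baseChange_quadratic) (hISO : bsdRHS_eq_of_isIsogenous)
    (hHW : ∀ (W : WeierstrassCurve ℚ) [W.IsElliptic] (ℓ : ℕ) [Fact ℓ.Prime],
      W.hasseWeilEulerFactor_geomPoints ℓ)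
    (hPOS : re_entireLFunction_one_nonneg) (hTW₆ : isIsogenous_quadraticTwist_cmFieldDiscr_models) :
    bsdTriple_of_j_mem_maximalCMJInvariants_of_L_one_ne_zero :=
  have hS : singularModuli_classNumberOne := singularModuli_classNumberOne_of_three h3
  have hKn : LFunction_eq_of_isIsogenous :=
    LFunction_eq_of_isIsogenous_of_hasseWeilEulerFactor_geomPoints hHW
  have hTW : isIsogenous_quadraticTwist_cmFieldDiscr :=
    isIsogenous_quadraticTwist_cmFieldDiscr_of_models hTW₆
  bsdTriple_of_j_mem_maximalCMJInvariants_of_L_one_ne_zero_of_pPart_of_classical hB hR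
    (finite_point_of_j_mem_maximalCMJInvariants_of_L_one_ne_zero_of_mem_prime_of_singularModuli h1 hS)
    (exists_isCMPeriod_of_j_mem_maximalCMJInvariants_of_singularModuli hS)
    (Deuring_LFunction_baseChange_cmField_of_artinFormalism hBCL hTW hKn) hmod hBCL hBC hISO hKn
    hPOS hTW

end Literature.NumberTheory.EllipticCurves

end
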